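/-
Copyright (c) 2026. All rights reserved.
Released under Apache 2.0 license as described in the file LICENSE.
Authors: abc-iut cell — seat abc-iut-f-060 (block F fact-proving wave; FACT-LIST rows F-0207 / F-0003 / F-0405 /
F-0406 at a closed genuine-in-group-theory instance).
-/
import Literature.AnabelianGeometry.AbsoluteAnabelian.AbsTopIChainsCuspidalFacts
import Literature.AnabelianGeometry.AbsoluteAnabelian.ZHatCompletionFreeProcyclic
import Literature.AnabelianGeometry.SemiGraphs.ProfiniteFreeTwoProcyclicCommensurator
import Literature.AnabelianGeometry.SemiGraphs.OncePuncturedTemperedGroupWitness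
import HarnessLib

/-!
# [AbsTopI] Lemma 4.5 (vi), [AbsAnab] Lemma 1.3.7, [AbsTopIII] Thm 1.11 (b), Prop 1.4 (i) HOLD TOGETHER
# at `Π = G × F̂₂`, one cusp `D = G × Ẑ·a`

S. Mochizuki, *Topics in Absolute Anabelian Geometry I* [MochizukiAbsTopI2012], Lemma 4.5 (vi) p. 55 ("Let
`I ⊆ Π` be a decomposition group of a cusp. Then `I = C_Π(I ∩ Δ)`"); *The Absolute Anabelian Geometry of
Hyperbolic Curves* [MochizukiAbsAnab2004], Lemma 1.3.7 p. 18 ("`I_x ⊆ Δ_X` is commensurably terminal");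
*Topics … III* [MochizukiAbsTopIII2015], Thm 1.11 (b) p. 46 ("`D_x` … may then be constructed as the
normalizer … of `I_x`"), Prop 1.4 (i) p. 31 (the inertia groups of cusps, "each of which is naturally
isomorphic to `Ẑ(1)`").  The cell types the four conclusions as the predicates
`CuspidalData.DecompEqCommensuratorOfInertia` (F-0207), `CuspidalData.InertiaCommensurablyTerminal` (F-0003),
`CuspidalData.DecompEqNormalizer` (F-0405), `CuspidalData.InertiaFreeProcyclic` (F-0406) on abstract cuspidal
data; their universal closures are false (`AbsTopIChainsCuspidalFacts.lean`, f-051's / f-095's schema files).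

This PROOF-ONLY file (no `def` / `instance` / `structure`; witnesses inside one `∃`) records a CLOSED,
NON-DEGENERATE instance at which ALL FOUR HOLD (`CuspidalData.exists_prod_freeTwo_model`): for every profinite
group `G`, the extension `Π := G × F̂₂ ↠ G` (first projection; `Δ = 1 × F̂₂ ≃ₜ* F̂₂`, the free profinite group
on `a, b` — the geometric fundamental group of a once-punctured elliptic curve or a thrice-punctured line over
an algebraically closed field of characteristic `0` has this shape) with ONE cusp whose decomposition group is
`D := G × îa(Ẑ)`, `îa(Ẑ) = cl η⟨a⟩ ≅ Ẑ` the closed procyclic subgroup of the generator `a` (so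
`I = D ∩ Δ = 1 × îa(Ẑ)`).  The group theory is abc-iut-w5-d040's `FreeTwoProcyclic.commensurator_eq_of_le_one_prod`
(`ProfiniteFreeTwoProcyclicCommensurator.lean`: `C_{G × F̂₂}(1 × îa(Ẑ)) = G × îa(Ẑ)`, from the
Magnus–Karrass–Solitar centraliser theorem in `F₂` completed), which IS (vi) at this datum; F-0003 and
F-0405 then follow from abc-iut-f-060's structure theorem `CuspidalData.decompEqCommensuratorOfInertia_iff`;
F-0406 is `I = 1 × îa(Ẑ) ≃ₜ* Ẑ` (`îa` is a closed embedding: `ê_a ∘ îa = id` by the pointed universal property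
of `Ẑ`, abc-iut's `ZHatCompletion.monoidHom_ext_of_continuous`; a continuous bijection from a compact group is a
homeomorphism) transported from `isFreeProcyclic_zHatCompletion` (`ZHatCompletionFreeProcyclic.lean`).
With `G := G_{ℚ_p}` (`absoluteGaloisGrp ℚ_[p]`) this is abc-iut-w5-d197's target `Π = G_{ℚ_p} × F̂₂`
(`AbsTopI.TargetData.exists_slim_prod`), now carrying a cusp.

HONEST LABEL: a direct product with a hand-placed cusp, not the étale `π₁` of a curve with its cuspidal
decomposition groups (no such `π₁` is constructed in the tree); a joint-satisfiability witness of three typed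
predicates at a genuine free-profinite `Δ`, i.e. consistency evidence; instantiated ≠ endorsed; nothing here
bears on [IUTchIII] Cor. 3.12; typed ≠ proved elsewhere.
-/

noncomputable section

namespace Literature.AnabelianGeometry.AbsoluteAnabelian.FundamentalExtension

open Literature.IUT.HodgeTheaters (profiniteCompletion toCompletion)
open Literature.AnabelianGeometry.SemiGraphs

/-- **Joint closed instance of F-0207 / F-0003 / F-0405 / F-0406 at `Π = G × F̂₂`, one cusp `D = G × cl η⟨a⟩`.**
For every profinite group `G` there are an extension `E` with `G_E = G`, `Π_E = G × F̂₂` (augmentation the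
first projection, `Δ_E ≃ₜ* F̂₂`) and a single-cusp cuspidal datum `C` on it such that
`C.DecompEqCommensuratorOfInertia` ([AbsTopI] Lemma 4.5 (vi) as typed), `C.InertiaCommensurablyTerminal`
([AbsAnab] Lemma 1.3.7 as typed), `C.DecompEqNormalizer` ([AbsTopIII] Thm 1.11 (b) as typed) and
`C.InertiaFreeProcyclic` ([AbsTopIII] Prop 1.4 (i) as typed: `I ≅ Ẑ`) all hold.
[cite: MochizukiAbsTopI2012, Lemma 4.5 (vi) p.55] -/
theorem CuspidalData.exists_prod_freeTwo_model (G : ProfiniteGrp.{0}) :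
    ∃ (E : FundamentalExtension.{0}) (C : CuspidalData E),
      E.gal = G ∧ E.arith = ProfiniteGrp.of (G × profiniteCompletion (FreeGroup (Fin 2))) ∧
      Nonempty (E.geom ≃ₜ* profiniteCompletion (FreeGroup (Fin 2))) ∧ Nonempty C.Cusp ∧
      C.DecompEqCommensuratorOfInertia ∧ C.InertiaCommensurablyTerminal ∧ C.DecompEqNormalizer ∧
        C.InertiaFreeProcyclic := by
  classical
  let B : ProfiniteGrp.{0} := profiniteCompletion (FreeGroup (Fin 2))
  let Zh : ProfiniteGrp.{0} := profiniteCompletion (Multiplicative ℤ)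
  -- the exponent sum `σ_a`, its completion `ê_a : F̂₂ → Ẑ`, and `îa : Ẑ → F̂₂` completing `k ↦ a^k`
  let σa : FreeGroup (Fin 2) →* Multiplicative ℤ :=
    FreeGroup.lift fun i => if i = 0 then Multiplicative.ofAdd 1 else 1
  let e : B →ₜ* Zh :=
    (ProfiniteGrp.ProfiniteCompletion.lift (GrpCat.ofHom ((toCompletion (Multiplicative ℤ)).comp σa))).hom
  let îa : Zh →ₜ* B :=
    (ProfiniteGrp.ProfiniteCompletion.lift
      (GrpCat.ofHom ((toCompletion (FreeGroup (Fin 2))).comp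
        (zpowersHom (FreeGroup (Fin 2)) (FreeGroup.of 0))))).hom
  have hσaa : σa (FreeGroup.of 0) = Multiplicative.ofAdd 1 := by simp [σa]
  have he : ∀ g, e (toCompletion _ g) = toCompletion _ (σa g) := fun g =>
    lift_hom_toCompletion Zh ((toCompletion (Multiplicative ℤ)).comp σa) g
  have hîa : ∀ k : ℤ, îa (toCompletion _ (Multiplicative.ofAdd k)) = toCompletion _ (FreeGroup.of 0 ^ k) :=
    fun k => by
      have h := lift_hom_toCompletion B
        ((toCompletion (FreeGroup (Fin 2))).comp (zpowersHom (FreeGroup (Fin 2)) (FreeGroup.of 0)))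
        (Multiplicative.ofAdd k)
      rw [MonoidHom.comp_apply, zpowersHom_apply, toAdd_ofAdd] at h
      exact h
  -- `ê_a ∘ îa = id` (both continuous, agree on `η(1)`; `η(ℤ)` is dense in `Ẑ`), so `îa` is injective
  have heîa : ∀ z, e (îa z) = z := by
    have hfun : e.toMonoidHom.comp îa.toMonoidHom = MonoidHom.id _ :=
      ZHatCompletion.monoidHom_ext_of_continuous (e.continuous.comp îa.continuous) continuous_id (by
        change e (îa (toCompletion _ (Multiplicative.ofAdd (1 : ℤ)))) =
          toCompletion _ (Multiplicative.ofAdd (1 : ℤ))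
        rw [hîa 1, zpow_one, he, hσaa])
    exact fun z => DFunLike.congr_fun hfun z
  have hîa_inj : Function.Injective îa := fun z₁ z₂ h => by rw [← heîa z₁, ← heîa z₂, h]
  -- the extension `Π := G × F̂₂ ↠ G`
  let E : FundamentalExtension.{0} :=
    { arith := ProfiniteGrp.of (G × B)
      gal := G
      aug := ContinuousMonoidHom.fst G B
      aug_surjective := fun a => ⟨(a, 1), rfl⟩ }
  have hmem : ∀ x : G × B, x ∈ E.geom ↔ x.1 = 1 := fun x => E.mem_geom
  -- `Δ = 1 × F̂₂ ≃ₜ* F̂₂`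
  let eΔ : B ≃ₜ* E.geom :=
    { toFun := fun b => ⟨((1 : G), b), (hmem _).2 rfl⟩
      invFun := fun x => (x : G × B).2
      left_inv := fun _ => rfl
      right_inv := fun x => by
        apply Subtype.ext
        exact Prod.ext ((hmem x.1).1 x.2).symm rfl
      map_mul' := fun _ _ => Subtype.ext (Prod.ext (mul_one _).symm rfl)
      continuous_toFun := by
        apply Continuous.subtype_mk
        exact continuous_const.prodMk continuous_id
      continuous_invFun := continuous_snd.comp continuous_subtype_val }
  -- the cusp: `D = G × îa(Ẑ)` (closed: `îa(Ẑ)` is a continuous image of a compact group)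
  let D : Subgroup (G × B) := îa.toMonoidHom.range.comap (MonoidHom.snd G B)
  have hAcl : IsClosed ((îa.toMonoidHom.range : Subgroup B) : Set B) := by
    have : ((îa.toMonoidHom.range : Subgroup B) : Set B) = Set.range îa := by
      ext y
      simp only [SetLike.mem_coe, MonoidHom.mem_range, Set.mem_range]
      rfl
    rw [this]
    exact (isCompact_range îa.continuous).isClosed
  have hDclosed : IsClosed ((D : Subgroup E.arith) : Set E.arith) := hAcl.preimage continuous_snd
  obtain ⟨C, ⟨eC⟩, hC⟩ := CuspidalData.nonempty_single E D hDclosed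
  -- F-0406 at `C`: `I = D ∩ Δ = 1 × îa(Ẑ) ≃ₜ* Ẑ` (continuous bijection from a compact group) is free procyclic
  have hI : ∀ x, C.Icusp x = D ⊓ E.geom := fun x => by rw [C.Icusp_eq, hC x]
  have hIfp : C.InertiaFreeProcyclic := by
    intro x
    rw [hI x]
    let f : Zh →* (D ⊓ E.geom : Subgroup (G × B)) :=
      { toFun := fun z => ⟨((1 : G), îa z), ⟨⟨z, rfl⟩, (hmem _).2 rfl⟩⟩
        map_one' := Subtype.ext (Prod.ext rfl (map_one îa))
        map_mul' := fun z₁ z₂ => Subtype.ext (Prod.ext (one_mul _).symm (map_mul îa z₁ z₂)) }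
    have hfc : Continuous f :=
      Continuous.subtype_mk (continuous_const.prodMk îa.continuous) _
    have hfb : Function.Bijective f := by
      constructor
      · intro z₁ z₂ h
        exact hîa_inj (congrArg (fun y : (D ⊓ E.geom : Subgroup (G × B)) => (y : G × B).2) h)
      · rintro ⟨y, ⟨z, hz⟩, hy⟩
        refine ⟨z, Subtype.ext (Prod.ext ((hmem y).1 hy).symm ?_)⟩
        exact hz
    let φ : Zh ≃ₜ* (D ⊓ E.geom : Subgroup (G × B)) :=
      { (hfc.homeoOfEquivCompactToT2 (f := Equiv.ofBijective f hfb) : Zh ≃ₜ _) with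
        map_mul' := map_mul f }
    exact isFreeProcyclic_zHatCompletion.of_continuousMulEquiv φ
  -- (vi) at `C`: `C_Π(D ∩ Δ) = C_{G × F̂₂}(1 × îa(Ẑ)) = G × îa(Ẑ) = D`
  have hvi : C.DecompEqCommensuratorOfInertia := by
    intro x
    rw [hC x]
    refine (FreeTwoProcyclic.commensurator_eq_of_le_one_prod e îa σa hσaa he hîa (D ⊓ E.geom)
      (fun y hy => ⟨(hmem y).1 hy.2, hy.1⟩) Nat.one_pos ⟨?_, (hmem _).2 rfl⟩).symm
    change ((1 : G), toCompletion _ (FreeGroup.of (0 : Fin 2)) ^ 1).2 ∈ îa.toMonoidHom.range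
    rw [pow_one]
    exact FreeTwoProcyclic.eta_of_zero_mem_range îa hîa
  have h := C.decompEqCommensuratorOfInertia_iff.mp hvi
  exact ⟨E, C, rfl, rfl, ⟨eΔ.symm⟩, ⟨eC.symm PUnit.unit⟩, hvi, h.1, h.2, hIfp⟩

end Literature.AnabelianGeometry.AbsoluteAnabelian.FundamentalExtension

end
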